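import Summits.ValiantsHypothesis.ValiantsHypothesis.Theorems.KPlusLogSqLawTridiagonalRealStaticUnitSignAutomaton

/-!
# Route «KPlusLogSqLaw», crux `WeakLifting` (stmt-ValiantsHypothesis-19561) — REAL side of the tridiagonal sector:
# the UNIT-COEFFICIENT sub-sector, ALL SIZES — INVARIANT METHOD for the pivot sign automaton and the PERIOD-`(+,+,−)` EMPTY FAMILY

HONEST FRAMING.  Helper theorems (`--supports stmt-ValiantsHypothesis-19561 --as helper`), seat val-sym-lift-p1 (g17), cell `pub-symmetroid`,
2026-08-28; sequel of `…UnitSignAutomaton` (sound emptiness criterion `noZero`).  For PARAMETRIC families of sign words the finite check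
`noZero w n = true` is replaced by an INVARIANT: a sequence of state sets `S k` containing the start state, closed under `step`, and avoiding
`Z` at the end (`noZero_of_invariant`).  Worked family: the period-three word `(+, +, −)^j` — slopes `L_{3i} > 0`, `L_{3i+1} > 0`, `L_{3i+2} < 0` —
whose runs cycle through `{E} → {A} → {A,Z,N} → {N,P0,J} → {J,E,A} → {A,Z,N} → …` on `(0,1)` and `{E} → {N} → {J} → {A} → {N} → …` on `(1,∞)`:
* **PERIOD-`(+,+,−)` EMPTY FAMILY** (`card_posRoots_unit_ppm_pow_eq_zero`): for every `j ≥ 1`, a unit design of size `3j+1` with slope signs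
  `(+,+,−)^j` has NO positive determinant zero (sizes `4, 7, 10, 13, …`; `j = 1` is `Q₄(+,+,−) < 0`, `j = 2` the class `+ + − + + −` of the size-7
  census, `j = 3` the class `+ + − + + − + + −` of the size-10 census).
Nothing here is an upper law for the register (α NO MOVER); nothing bears on `WeakLifting` / `TropicalB` (stmt-19771) in their windows,
Conjecture B, the Door-A registers, `MatrixDescartes` (stmt-18050) or VP ≠ VNP.
[this seat]
-/

-- `Summit.ValiantsHypothesis.ValiantsHypothesis.…` repeats a component by the D-0017 layout (single-conjunct summit); the name is mandated.
set_option linter.dupNamespace false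
set_option autoImplicit false

namespace Summit.ValiantsHypothesis.ValiantsHypothesis.Theorems.KPlusLogSqLaw
namespace StaticTridiagonalRealUnit

open Polynomial Finset
open Summit.ValiantsHypothesis.ValiantsHypothesis.Theorems.KPlusLogSqLaw.StaticTridiagonalRealPotential (pathDet)
open PState

/-! ### The invariant method -/

/-- **invariant method**: if state sets `S k` contain `E` at `k = 0` and are closed under the automaton step along the word `w`, then every branch of
`runN w n` has its state in `S n`. [this file] -/
theorem runN_subset_of_invariant (w : ℕ → Bool) (S : ℕ → PState → Prop) (h0 : S 0 E)
    (hstep : ∀ k, ∀ s, S k s → ∀ q ∈ step (w k) s, S (k + 1) q.1) (n : ℕ) :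
    ∀ p ∈ runN w n, S n p.1 := by
  induction n with
  | zero => intro p hp; simp [runN] at hp; rw [hp]; exact h0
  | succ n ih =>
    intro p hp
    simp only [runN, List.mem_flatMap, List.mem_map] at hp
    obtain ⟨p₀, hp₀, q, hq, rfl⟩ := hp
    exact hstep n p₀.1 (ih p₀ hp₀) q hq

/-- hence `noZero w n` holds as soon as `Z ∉ S n`. [this file] -/
theorem noZero_of_invariant (w : ℕ → Bool) (S : ℕ → PState → Prop) (h0 : S 0 E)
    (hstep : ∀ k, ∀ s, S k s → ∀ q ∈ step (w k) s, S (k + 1) q.1) (n : ℕ) (hZ : ¬ S n Z) : noZero w n = true := by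
  unfold noZero
  rw [List.all_eq_true]
  intro p hp
  have h := runN_subset_of_invariant w S h0 hstep n p hp
  have : p.1 ≠ Z := fun hz => hZ (hz ▸ h)
  simpa using this

/-! ### The period-`(+,+,−)` family -/

/-- invariant on the side `(0,1)` (recessive = ascending; word `w k = [k % 3 ≠ 2]`): the reachable states are contained in
`{E,N,P0,J}` / `{J,E,A}` / `{A,Z,N}` according as `k ≡ 0 / 1 / 2 (mod 3)`. [this file] -/
theorem ppm_noZero_lt_one (j : ℕ) : noZero (fun k => decide (k % 3 ≠ 2)) (3 * j) = true := by
  refine noZero_of_invariant (fun k => decide (k % 3 ≠ 2))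
    (fun k s => (k % 3 = 0 → s = E ∨ s = N ∨ s = P0 ∨ s = J) ∧ (k % 3 = 1 → s = J ∨ s = E ∨ s = A) ∧
      (k % 3 = 2 → s = A ∨ s = Z ∨ s = N)) (by simp) ?_ (3 * j) ?_
  · intro k s hs q hq
    have hk : k % 3 = 0 ∨ k % 3 = 1 ∨ k % 3 = 2 := by omega
    rcases hk with hk | hk | hk
    · have hw : decide (k % 3 ≠ 2) = true := by simp [hk]
      rw [hw] at hq
      rcases hs.1 hk with h | h | h | h <;> subst h <;> simp [step] at hq <;>
        (rcases hq with rfl | rfl | rfl) <;>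
        (refine ⟨fun h => ?_, fun h => ?_, fun h => ?_⟩ <;> first | (exfalso; omega) | simp)
    · have hw : decide (k % 3 ≠ 2) = true := by simp [hk]
      rw [hw] at hq
      rcases hs.2.1 hk with h | h | h <;> subst h <;> simp [step] at hq <;>
        (rcases hq with rfl | rfl | rfl) <;>
        (refine ⟨fun h => ?_, fun h => ?_, fun h => ?_⟩ <;> first | (exfalso; omega) | simp)
    · have hw : decide (k % 3 ≠ 2) = false := by simp [hk]
      rw [hw] at hq
      rcases hs.2.2 hk with h | h | h <;> subst h <;> simp [step] at hq <;>
        (rcases hq with rfl | rfl | rfl) <;>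
        (refine ⟨fun h => ?_, fun h => ?_, fun h => ?_⟩ <;> first | (exfalso; omega) | simp)
  · simp

/-- invariant on the side `(1,∞)` (recessive = descending; word `k ↦ [k % 3 = 2]`): reachable states `{E,A}` / `{N}` / `{J}`. [this file] -/
theorem ppm_noZero_gt_one (j : ℕ) : noZero (fun k => !decide (k % 3 ≠ 2)) (3 * j) = true := by
  refine noZero_of_invariant (fun k => !decide (k % 3 ≠ 2))
    (fun k s => (k % 3 = 0 → s = E ∨ s = A) ∧ (k % 3 = 1 → s = N) ∧ (k % 3 = 2 → s = J)) (by simp) ?_ (3 * j) ?_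
  · intro k s hs q hq
    have hk : k % 3 = 0 ∨ k % 3 = 1 ∨ k % 3 = 2 := by omega
    rcases hk with hk | hk | hk
    · have hw : (!decide (k % 3 ≠ 2)) = false := by simp [hk]
      rw [hw] at hq
      rcases hs.1 hk with h | h <;> subst h <;> simp [step] at hq <;>
        (rcases hq with rfl | rfl | rfl) <;>
        (refine ⟨fun h => ?_, fun h => ?_, fun h => ?_⟩ <;> first | (exfalso; omega) | simp)
    · have hw : (!decide (k % 3 ≠ 2)) = false := by simp [hk]
      rw [hw] at hq
      have h := hs.2.1 hk
      subst h; simp [step] at hq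
      subst hq
      refine ⟨fun h => ?_, fun h => ?_, fun h => ?_⟩ <;> first | (exfalso; omega) | simp
    · have hw : (!decide (k % 3 ≠ 2)) = true := by simp [hk]
      rw [hw] at hq
      have h := hs.2.2 hk
      subst h; simp [step] at hq
      subst hq
      refine ⟨fun h => ?_, fun h => ?_, fun h => ?_⟩ <;> first | (exfalso; omega) | simp
  · simp

/-- **PERIOD-`(+,+,−)` EMPTY FAMILY (all sizes `3j+1`).**  If the slopes satisfy `L_{3i} > 0`, `L_{3i+1} > 0`, `L_{3i+2} < 0` for all `i < j`
(`j ≥ 1`), the unit design of size `3j+1` has NO positive determinant zero. [this file] -/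
theorem card_posRoots_unit_ppm_pow_eq_zero (d f : ℕ → ℕ) (j : ℕ)
    (h : ∀ i, i < j → d (3 * i) + d (3 * i + 1) < 2 * f (3 * i) ∧ d (3 * i + 1) + d (3 * i + 2) < 2 * f (3 * i + 1) ∧
      2 * f (3 * i + 2) < d (3 * i + 2) + d (3 * i + 3)) :
    ((pathDet (fun _ => (1 : ℝ)) d (fun _ => (1 : ℝ)) f (3 * j + 1)).roots.toFinset.filter (fun x => 0 < x)).card = 0 := by
  refine card_posRoots_unit_eq_zero_of_automaton d f (3 * j) (fun k => decide (k % 3 ≠ 2)) (fun k hk => ?_)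
    (ppm_noZero_lt_one j) (ppm_noZero_gt_one j) (by omega)
  obtain ⟨h0, h1, h2⟩ := h (k / 3) (by omega)
  have hk3 : k % 3 = 0 ∨ k % 3 = 1 ∨ k % 3 = 2 := by omega
  rcases hk3 with hr | hr | hr
  · have e : k = 3 * (k / 3) := by omega
    refine ⟨fun _ => ?_, fun hf => by simp [hr] at hf⟩
    rw [e]; simpa using h0
  · have e : k = 3 * (k / 3) + 1 := by omega
    refine ⟨fun _ => ?_, fun hf => by simp [hr] at hf⟩
    rw [e]; simpa [Nat.add_assoc] using h1
  · have e : k = 3 * (k / 3) + 2 := by omega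
    refine ⟨fun ht => by simp [hr] at ht, fun _ => ?_⟩
    rw [e]; simpa [Nat.add_assoc] using h2

end StaticTridiagonalRealUnit
end Summit.ValiantsHypothesis.ValiantsHypothesis.Theorems.KPlusLogSqLaw
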